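import Summits.MatrixMultiplication.MatrixMultiplication.Theorems.AbelianSTPPCensusShapeCertVQKSearchP
import Summits.MatrixMultiplication.MatrixMultiplication.Theorems.AbelianSTPPCensusShapeCertVQFinal

/-!
# Abelian STPP census — from the route vocabulary to the checker `ShapeCertVQ.checkQK` (vQK := vP ∧ E3⁺ ∧ E3K)

Cell mm-stpp, rung F-M1; successor kernel item «vQK T_E ladder beyond 471» in support of the closed crux item
stmt-MatrixMultiplication-19191; seat mm-stpp-vp-p2 (gen 3).  The one-order bridge for the checker `checkQK` of `…ShapeCertVQKDefs`,
after g1's `ShapeCertVQ.shapeExclusionVQ_of_checkQ` (`…ShapeCertVQFinal`: `inUniv_shp`, `admM_GM`, `admG_GM`, `admE_GM`, `beats_gsumQ`)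
with `admK_GM` (`…VQKSemantics`) and `checkQK_sound` (`…VQKSearch`):
**if `checkQK M = true` (`M ≤ 489`) then no shape list with at least two members satisfying `SieveAdmissibleVP M`, `E3pAdm M` and
`E3kAdm M` beats `5/2`** — and the same from the root path node (`shapeExclusionVQK_of_pathOKK`, for orders assembled from path
segments).  Kernel evaluations: `…ShapeCertVQEvalK*`; leaves: `…LeafTE…`.
WHAT THIS IS NOT: no statement about STPP families or `ω` by itself (the rules vP, E3⁺, E3K are sound theorems of the cell —
`sieveSound` / `u11GSound_holds` / `u11PSound`, `e3pAdm_of_isSTPP`, `e3kAdm_of_isSTPP` — applied only in the leaf).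
-/

set_option linter.dupNamespace false -- `MatrixMultiplication.MatrixMultiplication` (summit = problem, D-0017)
set_option autoImplicit false

namespace Summit.MatrixMultiplication.MatrixMultiplication.Theorems.ShapeCertVQ

open ShapeCert ShapeCertVP STPPThreeRoomEnergy Finset

/-- **From the checker `checkQK` to the vQK shape exclusion at one order.**  If `checkQK M = true` (`M ≤ 489`), no shape list with at
least two members satisfying the vP sieve system, E3⁺ (`E3pAdm`) and E3K (`E3kAdm`) beats `5/2` at order `M`. [original] -/
theorem shapeExclusionVQK_of_checkQK {M : ℕ} (hM : M ≤ 489) (hc : checkQK M = true) :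
    ∀ (N : ℕ) (a b c : Fin N → ℕ), 2 ≤ N → SieveAdmissibleVP M a b c → E3pAdm M a b c → E3kAdm M a b c →
      ¬ Beats (5 / 2) M a b c := by
  intro N a b c hN hVP hE hK hB
  obtain ⟨hS, hG, -⟩ := hVP
  exact checkQK_sound hc hM (GM a b c)
    (fun x hx => by obtain ⟨i, rfl⟩ := (mem_GM a b c).mp hx; exact inUniv_shp a b c hN hS i)
    (admM_GM a b c hN hS) (admG_GM a b c hS hG) (admE_GM a b c hE) (admK_GM a b c hK) (beats_gsumQ a b c hS hM hB)

/-- **The same from the root path node** (`PathOKK M []`, assembled from kernel-evaluated path segments). [original] -/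
theorem shapeExclusionVQK_of_pathOKK {M : ℕ} (hM : M ≤ 489) (h : PathOKK M []) :
    ∀ (N : ℕ) (a b c : Fin N → ℕ), 2 ≤ N → SieveAdmissibleVP M a b c → E3pAdm M a b c → E3kAdm M a b c →
      ¬ Beats (5 / 2) M a b c :=
  shapeExclusionVQK_of_checkQK hM (checkQK_of_pathOKK_nil h)

end Summit.MatrixMultiplication.MatrixMultiplication.Theorems.ShapeCertVQ
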